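import Summits.NavierStokesRegularity.FluidComputer.PalasekTowerStrainDoorAtRaw
import Literature.Analysis.FluidPDE.VorticityEquation
import Literature.Analysis.FluidPDE.VorticityCalculus
import Literature.Analysis.FluidPDE.RapidDecayLemmas
import Mathlib.Analysis.SpecialFunctions.JapaneseBracket

/-!
# THE WEIGHT DOOR, FIRST LEMMA: the weighted linearised enstrophy of a classical solution of the
# Navier–Stokes system LINEARISED at a design grows at most like `e^{2∫Λ}` under a CURL-PAIRING
# CERTIFICATE of the design (Gallay–Wayne / Maekawa weighted-energy structure, a-posteriori form)

Cell `ns-blowup`, seat `ns-palasek-20303-p1` (LEAD prover on stmt-NavierStokesRegularity-20303 `EpisodeBaseT`;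
route `PalasekTowerBreakdown`, rev 19). Crux idea `weightdoor` (cstrat-19179, `Cruxes/EpisodeBase/Ideas/weightdoor.md`,
f8ccf73ab94b; sketch `Cruxes/EpisodeBase/WeightdoorSketch.lean`, 21b162756f8d) = route (C) of the certificate road:
measure the distance between a designed pseudo-run and the true free run in a WEIGHTED VORTICITY norm
`∫ ρ |curl(v − w)|²` and certify, for the design, the top `Λ(t)` of the weighted enstrophy-production pairing —
the Grönwall fee is then `e^{∫Λ}` instead of route (A)'s `e^{∫Γ}` (`Γ` = maximal compression rate,
`PalasekTowerStrainShadowedRun`), and for the strain–diffusion balance of a held core the weighted form is a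
contraction (Fokker–Planck structure; tree: `AsymBurgersUniformEnergy`, `GaussianVortexPoincare`). LABEL: E–C typing
+ kernel analysis (two open-ended DEFINITIONS — the linearised solution class on `ℝ³` and the raw curl-pairing
certificate — and one THEOREM). WHAT THIS IS NOT: not Navier–Stokes evidence — a linear energy inequality for a
GIVEN linearised solution under a GIVEN certificate; no design, weight, certificate or run is exhibited; the
nonlinear door of route (C) and its certificate are NOT in this file.

* `IsClassicalLinearizedNSSolutionOn S w g f π` — classical solutions on `S × ℝ³` of Navier–Stokes LINEARISED at
  the reference `w` (unit viscosity) with source `g`: `∂ₜf + (w·∇)f + (f·∇)w = Δf − ∇π + g`, `div f = 0`, `f, π`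
  jointly smooth (the fields of `IsClassicalNSSolutionOn` with the linearised momentum; the torus analogue is
  `NavierStokesConcentrationCorrector.IsLinearizedNSSolutionOn`).
* `curlPairing w ρ v` — **the RAW weighted curl pairing** `2 ∫ ρ ⟪curl v, curl(Δv − (w·∇)v − (v·∇)w)⟫`: exactly
  the time derivative of `∫ ρ |curl f|²` along the homogeneous linearised flow BEFORE any integration by parts
  (after the integrations by parts of the idea card — `div w = 0`, decay — it is the self-adjoint form
  `∫ (w·∇ρ + Δρ)|ζ|² − 2ρ|∇ζ|² + 2ρ⟪(∇w)ζ, ζ⟫ + 2ρ⟪(Ω·∇)v − (v·∇)Ω, ζ⟫`, `ζ = curl v`, `Ω = curl w`; that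
  rewriting is the certificate's business and is not used here).
* `CurlPairingCertificate T w ρ Λ` — **the certificate**: `curlPairing (w t) ρ v ≤ 2Λ(t) ∫ ρ |curl v|²` for every
  `t ∈ [0, T]` and every smooth, rapidly decaying, divergence-free test field `v` (the class of the slices of a
  rapidly decaying classical solution — no density argument is needed).
* **`weightedEnstrophy_le_exp_of_curlPairingCertificate`** — THE FIRST LEMMA: for a classical solution `f` of
  the HOMOGENEOUS linearised system on `[0, T]` with uniform Schwartz bounds, a smooth weight `ρ = ϑ²` with `ϑ`
  of polynomial growth, and a continuous `Λ ≥ 0` carrying the certificate,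
  `∫ ϑ² |curl f(t)|² ≤ exp(2 ∫₀ᵗ Λ) · ∫ ϑ² |curl f(0)|²` on `[0, T]`. Proof: the `L²` balance of the jointly
  smooth field `ϑ · curl f` (`IsSmoothSpaceTimeOn.l2_balance`; its `L²` bounds from the Schwartz bounds of `Df`,
  `D∂ₜf` against the polynomial weight), `∂ₜ curl f = curl ∂ₜf` (`IsSmoothSpaceTimeOn.curl_timeDerivWithin`),
  the curl of the linearised momentum equation (`curl ∇π = 0`), the certificate at the slice `f(t)`, and the
  square-root Grönwall lemma `sqrt_le_mul_exp_of_le_add_intervalIntegral`. No bound on the design `w` enters.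

References: Th. Gallay, C. E. Wayne, Comm. Math. Phys. 255 (2005) 97–129 [cite: GallayWayne2005, Thm. 1.1];
Th. Gallay, Y. Maekawa, arXiv:1002.2489, Thm. 1.1 [cite: GallayMaekawa2010, Thm. 1.1]; Y. Maekawa, Math. Models
Methods Appl. Sci. 19 (2009), Prop. 4.1 [cite: Maekawa2009b, Prop. 4.1]; M. Dashti, J. C. Robinson, SIAM J. Numer.
Anal. 46 (2008), Thm. 5 [cite: DashtiRobinson2008, Thm. 5]; S. Palasek, arXiv:2605.13827 §4 [cite: Palasek2026ElementaryModel, §4].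
-/

noncomputable section

namespace Summit.NavierStokesRegularity.FluidComputer.PalasekTowerClayBridge.WeightDoor

open Set MeasureTheory Metric Function InnerProductSpace Filter Topology
open scoped ENNReal NNReal ContDiff RealInnerProductSpace Laplacian
open Literature.Analysis Literature.Analysis.FluidPDE

/-! ## §1 Linearised solutions, the raw curl pairing and its certificate -/

/-- **Classical solutions of Navier–Stokes LINEARISED at a reference field `w`** (unit viscosity) with source
`g` on the time set `S`: `f, π` jointly smooth on `S × ℝ³`, `∂ₜf + (w·∇)f + (f·∇)w = Δf − ∇π + g` pointwise on
`S × ℝ³` (one-sided time derivative within `S`), `div f = 0`. The fields of `IsClassicalNSSolutionOn` with the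
momentum equation replaced by its linearisation. [cite: GallayMaekawa2010, Thm. 1.1] -/
structure IsClassicalLinearizedNSSolutionOn (S : Set ℝ)
    (w g f : ℝ → EuclideanSpace ℝ (Fin 3) → EuclideanSpace ℝ (Fin 3)) (π : ℝ → EuclideanSpace ℝ (Fin 3) → ℝ) :
    Prop where
  /-- the velocity perturbation is jointly smooth on `S × ℝ³` -/
  smooth_velocity : IsSmoothSpaceTimeOn S f
  /-- the pressure perturbation is jointly smooth on `S × ℝ³` -/
  smooth_pressure : IsSmoothSpaceTimeOn S π
  /-- the LINEARISED momentum equation -/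
  momentum : ∀ t ∈ S, ∀ x,
    FluidPDE.timeDerivWithin S f t x + convect (w t) (f t) x + convect (f t) (w t) x =
      (Δ (f t)) x - gradient (π t) x + g t x
  /-- incompressibility -/
  divFree : ∀ t ∈ S, VectorCalculus.IsDivFree (f t)

/-- **The RAW weighted curl pairing** of a test field `v` against the design slice `w` and the weight `ρ`:
`2 ∫ ρ(x) ⟪curl v(x), curl(Δv − (w·∇)v − (v·∇)w)(x)⟫ dx` — the time derivative of `∫ ρ |curl f|²` along the
homogeneous linearised flow, before integration by parts. [cite: GallayMaekawa2010, Thm. 1.1] -/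
def curlPairing (w : EuclideanSpace ℝ (Fin 3) → EuclideanSpace ℝ (Fin 3)) (ρ : EuclideanSpace ℝ (Fin 3) → ℝ)
    (v : EuclideanSpace ℝ (Fin 3) → EuclideanSpace ℝ (Fin 3)) : ℝ :=
  ∫ x, 2 * ρ x * ⟪curl v x, curl (fun y => (Δ v) y - convect w v y - convect v w y) x⟫

/-- **THE CURL-PAIRING CERTIFICATE** of a design `w` on `[0, T]` for the weight `ρ` and the rate `Λ`: for every
`t ∈ [0, T]` and every smooth, rapidly decaying, divergence-free test field `v`,
`curlPairing (w t) ρ v ≤ 2 Λ(t) ∫ ρ |curl v|²` — a bound on the top of a quadratic form of the design, checkable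
for an explicit design and weight without any run. [cite: GallayMaekawa2010, Thm. 1.1] [cite: DashtiRobinson2008, Thm. 5] -/
def CurlPairingCertificate (T : ℝ) (w : ℝ → EuclideanSpace ℝ (Fin 3) → EuclideanSpace ℝ (Fin 3))
    (ρ : EuclideanSpace ℝ (Fin 3) → ℝ) (Λ : ℝ → ℝ) : Prop :=
  ∀ t ∈ Icc 0 T, ∀ v : EuclideanSpace ℝ (Fin 3) → EuclideanSpace ℝ (Fin 3),
    ContDiff ℝ ∞ v → HasRapidSpatialDecay v → VectorCalculus.IsDivFree v →
      curlPairing (w t) ρ v ≤ 2 * Λ t * ∫ x, ρ x * ‖curl v x‖ ^ 2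

/-! ## §2 Plumbing: an `L²` bound from quadratic decay -/

/-- A field on `ℝ³` bounded by `C (1 + ‖x‖)⁻²` has `∫ ‖·‖² ≤ C² ∫ (1 + ‖x‖)⁻⁴ < ∞`. [folklore] -/
private theorem lintegral_enorm_sq_le_of_decay_two {F : Type*} [NormedAddCommGroup F]
    {g : EuclideanSpace ℝ (Fin 3) → F} {C : ℝ}
    (hg : ∀ x, ‖g x‖ ≤ C * (1 + ‖x‖) ^ (-(2 : ℝ))) :
    ∫⁻ x, ‖g x‖ₑ ^ 2 ≤
      ENNReal.ofReal (C ^ 2) * ∫⁻ x : EuclideanSpace ℝ (Fin 3), ENNReal.ofReal ((1 + ‖x‖) ^ (-(4 : ℝ))) := by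
  have hpt : ∀ x : EuclideanSpace ℝ (Fin 3),
      ‖g x‖ₑ ^ 2 ≤ ENNReal.ofReal (C ^ 2) * ENNReal.ofReal ((1 + ‖x‖) ^ (-(4 : ℝ))) := by
    intro x
    have hb : 0 < 1 + ‖x‖ := by positivity
    have h2 : ‖g x‖ ^ 2 ≤ C ^ 2 * (1 + ‖x‖) ^ (-(4 : ℝ)) := by
      calc ‖g x‖ ^ 2 ≤ (C * (1 + ‖x‖) ^ (-(2 : ℝ))) ^ 2 := pow_le_pow_left₀ (norm_nonneg _) (hg x) 2
        _ = C ^ 2 * ((1 + ‖x‖) ^ (-(2 : ℝ)) * (1 + ‖x‖) ^ (-(2 : ℝ))) := by ring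
        _ = C ^ 2 * (1 + ‖x‖) ^ (-(4 : ℝ)) := by rw [← Real.rpow_add hb]; norm_num
    calc ‖g x‖ₑ ^ 2 = ENNReal.ofReal (‖g x‖ ^ 2) := by rw [← ofReal_norm, ENNReal.ofReal_pow (norm_nonneg _)]
      _ ≤ ENNReal.ofReal (C ^ 2 * (1 + ‖x‖) ^ (-(4 : ℝ))) := ENNReal.ofReal_le_ofReal h2
      _ = ENNReal.ofReal (C ^ 2) * ENNReal.ofReal ((1 + ‖x‖) ^ (-(4 : ℝ))) :=
          ENNReal.ofReal_mul (sq_nonneg _)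
  calc ∫⁻ x, ‖g x‖ₑ ^ 2 ≤ ∫⁻ x : EuclideanSpace ℝ (Fin 3),
        ENNReal.ofReal (C ^ 2) * ENNReal.ofReal ((1 + ‖x‖) ^ (-(4 : ℝ))) := lintegral_mono hpt
    _ = ENNReal.ofReal (C ^ 2) * ∫⁻ x : EuclideanSpace ℝ (Fin 3), ENNReal.ofReal ((1 + ‖x‖) ^ (-(4 : ℝ))) :=
        lintegral_const_mul' _ _ ENNReal.ofReal_ne_top

/-- The weight integral `∫ (1 + ‖x‖)⁻⁴` on `ℝ³` is finite (`4 > 3 = dim`). [folklore] -/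
private theorem lintegral_decay_four_lt_top :
    ∫⁻ x : EuclideanSpace ℝ (Fin 3), ENNReal.ofReal ((1 + ‖x‖) ^ (-(4 : ℝ))) < ⊤ :=
  finite_integral_one_add_norm (by rw [finrank_euclideanSpace, Fintype.card_fin]; norm_num)

/-! ## §3 THE FIRST LEMMA -/

/-- **THE WEIGHT DOOR, FIRST LEMMA (weighted linearised enstrophy under a curl-pairing certificate).** Let `f` be
a classical solution on `[0, T]` (`T > 0`) of the Navier–Stokes system linearised at a design `w`, homogeneous
(source `0`), with uniform Schwartz bounds on the slab (`HasUniformRapidDecayOn`); let `ϑ` be a smooth weight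
amplitude of polynomial growth, `|ϑ(x)| ≤ C_ϑ (1 + ‖x‖)^m`, and `Λ ≥ 0` continuous on `[0, T]` such that the design
carries the curl-pairing certificate for the weight `ρ = ϑ²`. Then for every `t ∈ [0, T]`,
`∫ ϑ² |curl f(t)|² ≤ exp(2 ∫₀ᵗ Λ) · ∫ ϑ² |curl f(0)|²`. No bound on the design is used: `w` enters only through
the linearised equation and the certificate. [cite: GallayMaekawa2010, Thm. 1.1] [cite: GallayWayne2005, Thm. 1.1]
[cite: DashtiRobinson2008, Thm. 5] -/
theorem weightedEnstrophy_le_exp_of_curlPairingCertificate {T : ℝ} (hT : 0 < T)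
    {w f : ℝ → EuclideanSpace ℝ (Fin 3) → EuclideanSpace ℝ (Fin 3)} {π : ℝ → EuclideanSpace ℝ (Fin 3) → ℝ}
    (hsol : IsClassicalLinearizedNSSolutionOn (Icc 0 T) w 0 f π)
    (hd : HasUniformRapidDecayOn (Icc 0 T) f)
    {ϑ : EuclideanSpace ℝ (Fin 3) → ℝ} (hϑ : ContDiff ℝ ∞ ϑ) {Cϑ : ℝ} {m : ℕ}
    (hϑb : ∀ x, |ϑ x| ≤ Cϑ * (1 + ‖x‖) ^ m)
    {Λ : ℝ → ℝ} (hΛc : ContinuousOn Λ (Icc 0 T)) (hΛ0 : ∀ t ∈ Icc 0 T, 0 ≤ Λ t)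
    (hcert : CurlPairingCertificate T w (fun x => ϑ x ^ 2) Λ) :
    ∀ t ∈ Icc 0 T, ∫ x, ϑ x ^ 2 * ‖curl (f t) x‖ ^ 2 ≤
      Real.exp (2 * ∫ s in (0 : ℝ)..t, Λ s) * ∫ x, ϑ x ^ 2 * ‖curl (f 0) x‖ ^ 2 := by
  have hU : UniqueDiffOn ℝ (Icc 0 T) := uniqueDiffOn_Icc hT
  have hcl : Icc 0 T ⊆ closure (interior (Icc 0 T)) := by
    rw [interior_Icc, closure_Ioo hT.ne]
  have hf : IsSmoothSpaceTimeOn (Icc 0 T) f := hsol.smooth_velocity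
  have hπ : IsSmoothSpaceTimeOn (Icc 0 T) π := hsol.smooth_pressure
  have hCϑ : 0 ≤ Cϑ := by
    have h := hϑb 0
    simp only [norm_zero, add_zero, one_pow, mul_one] at h
    exact (abs_nonneg _).trans h
  -- the vorticity and the weighted vorticity, jointly smooth
  set ζ : ℝ → EuclideanSpace ℝ (Fin 3) → EuclideanSpace ℝ (Fin 3) := vorticity f with hζdef
  have hζt : ∀ t, ζ t = curl (f t) := fun t => rfl
  have hζ : IsSmoothSpaceTimeOn (Icc 0 T) ζ := by
    have : ζ = fun t x => curlCLM (fderiv ℝ (f t) x) := by funext t x; rfl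
    rw [this]; exact (hf.fderiv_slice hU).clm_comp curlCLM
  obtain ⟨W, hWdef⟩ : ∃ W : ℝ → EuclideanSpace ℝ (Fin 3) → EuclideanSpace ℝ (Fin 3),
      W = fun t x => ϑ x • ζ t x := ⟨_, rfl⟩
  have hWtx : ∀ t x, W t x = ϑ x • ζ t x := fun t x => by rw [hWdef]
  have hW : IsSmoothSpaceTimeOn (Icc 0 T) W := by
    rw [hWdef]
    have h1 : ContDiffOn ℝ ∞ (fun q : ℝ × EuclideanSpace ℝ (Fin 3) => ϑ q.2) (Icc 0 T ×ˢ univ) :=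
      (hϑ.comp contDiff_snd).contDiffOn
    exact h1.smul hζ
  -- the time derivatives
  have hft : IsSmoothSpaceTimeOn (Icc 0 T) (FluidPDE.timeDerivWithin (Icc 0 T) f) := hf.timeDerivWithin hU
  have hdt : HasUniformRapidDecayOn (Icc 0 T) (FluidPDE.timeDerivWithin (Icc 0 T) f) := hd.timeDerivWithin hf hU
  have hWt : ∀ t ∈ Icc 0 T, ∀ x, FluidPDE.timeDerivWithin (Icc 0 T) W t x =
      ϑ x • curl (FluidPDE.timeDerivWithin (Icc 0 T) f t) x := by
    intro t ht x
    rw [timeDerivWithin_apply]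
    have h1 : (fun s => W s x) = fun s => ϑ x • ζ s x := by funext s; rw [hWtx]
    rw [h1, derivWithin_fun_const_smul (ϑ x) (hζ.differentiableWithinAt_time ht x),
      ← timeDerivWithin_apply, hf.curl_timeDerivWithin hU hcl ht x]
  -- decay of the vorticity and of its time derivative against the weight
  obtain ⟨C₁, hC₁0, hC₁⟩ := hd.norm_fderiv_le_rpow hf hU (m + 2)
  obtain ⟨C₂, hC₂0, hC₂⟩ := hdt.norm_fderiv_le_rpow hft hU (m + 2)
  have hweight : ∀ (x : EuclideanSpace ℝ (Fin 3)) (C : ℝ), 0 ≤ C →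
      |ϑ x| * (‖curlCLM‖ * (C * (1 + ‖x‖) ^ (-((m + 2 : ℕ) : ℝ)))) ≤
        Cϑ * ‖curlCLM‖ * C * (1 + ‖x‖) ^ (-(2 : ℝ)) := by
    intro x C hC
    have hb : 0 < 1 + ‖x‖ := by positivity
    have hsplit : (1 + ‖x‖) ^ m * (1 + ‖x‖) ^ (-((m + 2 : ℕ) : ℝ)) = (1 + ‖x‖) ^ (-(2 : ℝ)) := by
      rw [← Real.rpow_natCast, ← Real.rpow_add hb]
      push_cast
      ring_nf
    calc |ϑ x| * (‖curlCLM‖ * (C * (1 + ‖x‖) ^ (-((m + 2 : ℕ) : ℝ))))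
        ≤ Cϑ * (1 + ‖x‖) ^ m * (‖curlCLM‖ * (C * (1 + ‖x‖) ^ (-((m + 2 : ℕ) : ℝ)))) :=
          mul_le_mul_of_nonneg_right (hϑb x) (by positivity)
      _ = Cϑ * ‖curlCLM‖ * C * ((1 + ‖x‖) ^ m * (1 + ‖x‖) ^ (-((m + 2 : ℕ) : ℝ))) := by ring
      _ = Cϑ * ‖curlCLM‖ * C * (1 + ‖x‖) ^ (-(2 : ℝ)) := by rw [hsplit]
  have hnormcurl : ∀ (v : EuclideanSpace ℝ (Fin 3) → EuclideanSpace ℝ (Fin 3)) (x : EuclideanSpace ℝ (Fin 3)),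
      ‖curl v x‖ ≤ ‖curlCLM‖ * ‖fderiv ℝ v x‖ := fun v x => by
    rw [curl_eq_curlCLM]; exact curlCLM.le_opNorm _
  have hWbd : ∀ t ∈ Icc 0 T, ∀ x, ‖W t x‖ ≤ Cϑ * ‖curlCLM‖ * C₁ * (1 + ‖x‖) ^ (-(2 : ℝ)) := by
    intro t ht x
    rw [hWtx, norm_smul, Real.norm_eq_abs, hζt]
    exact (mul_le_mul_of_nonneg_left ((hnormcurl (f t) x).trans
      (mul_le_mul_of_nonneg_left (hC₁ t ht x) (norm_nonneg curlCLM))) (abs_nonneg _)).trans (hweight x C₁ hC₁0)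
  have hWtbd : ∀ t ∈ Icc 0 T, ∀ x, ‖FluidPDE.timeDerivWithin (Icc 0 T) W t x‖ ≤
      Cϑ * ‖curlCLM‖ * C₂ * (1 + ‖x‖) ^ (-(2 : ℝ)) := by
    intro t ht x
    rw [hWt t ht x, norm_smul, Real.norm_eq_abs]
    exact (mul_le_mul_of_nonneg_left ((hnormcurl _ x).trans
      (mul_le_mul_of_nonneg_left (hC₂ t ht x) (norm_nonneg curlCLM))) (abs_nonneg _)).trans (hweight x C₂ hC₂0)
  -- the `L²` bounds of the balance
  set I4 : ℝ≥0∞ := ∫⁻ x : EuclideanSpace ℝ (Fin 3), ENNReal.ofReal ((1 + ‖x‖) ^ (-(4 : ℝ))) with hI4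
  have hI4top : I4 ≠ ⊤ := lintegral_decay_four_lt_top.ne
  set K₀ : ℝ≥0∞ := ENNReal.ofReal ((Cϑ * ‖curlCLM‖ * C₁) ^ 2) * I4 with hK₀
  set K₁ : ℝ≥0∞ := ENNReal.ofReal ((Cϑ * ‖curlCLM‖ * C₂) ^ 2) * I4 with hK₁
  have hK₀top : K₀ ≠ ⊤ := ENNReal.mul_ne_top ENNReal.ofReal_ne_top hI4top
  have hK₁top : K₁ ≠ ⊤ := ENNReal.mul_ne_top ENNReal.ofReal_ne_top hI4top
  have hB₀ : ∀ t ∈ Icc 0 T, ∫⁻ x, ‖W t x‖ₑ ^ 2 ≤ (K₀.toNNReal : ℝ≥0∞) := fun t ht => by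
    rw [ENNReal.coe_toNNReal hK₀top]
    exact lintegral_enorm_sq_le_of_decay_two (hWbd t ht)
  have hB₁ : ∀ t ∈ Icc 0 T, ∫⁻ x, ‖FluidPDE.timeDerivWithin (Icc 0 T) W t x‖ₑ ^ 2 ≤ (K₁.toNNReal : ℝ≥0∞) :=
    fun t ht => by
    rw [ENNReal.coe_toNNReal hK₁top]
    exact lintegral_enorm_sq_le_of_decay_two (hWtbd t ht)
  -- ### the `L²` balance of the weighted vorticity
  obtain ⟨hΦint, hEcont, hbal⟩ := hW.l2_balance hT hB₀ hB₁
  -- the energy `E` and its density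
  have hEW : ∀ t, (∫ x, ‖W t x‖ ^ 2) = ∫ x, ϑ x ^ 2 * ‖curl (f t) x‖ ^ 2 := fun t => by
    refine integral_congr_ae (Eventually.of_forall fun x => ?_)
    simp only [hWtx, hζt, norm_smul, Real.norm_eq_abs, mul_pow, sq_abs]
  -- ### the flux is the raw curl pairing at each slice
  have hflux : ∀ t ∈ Icc 0 T, (∫ x, 2 * ⟪W t x, FluidPDE.timeDerivWithin (Icc 0 T) W t x⟫) =
      curlPairing (w t) (fun x => ϑ x ^ 2) (f t) := by
    intro t ht
    -- the linearised momentum equation solved for `∂ₜf`, and its curl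
    have hmom : ∀ y, FluidPDE.timeDerivWithin (Icc 0 T) f t y =
        ((Δ (f t)) y - convect (w t) (f t) y - convect (f t) (w t) y) - gradient (π t) y := by
      intro y
      have h := hsol.momentum t ht y
      simp only [Pi.zero_apply, add_zero] at h
      have h' : FluidPDE.timeDerivWithin (Icc 0 T) f t y =
          (FluidPDE.timeDerivWithin (Icc 0 T) f t y + convect (w t) (f t) y + convect (f t) (w t) y) -
            convect (w t) (f t) y - convect (f t) (w t) y := by abel
      rw [h', h]; abel
    have hdiffA : ∀ y, DifferentiableAt ℝ
        (fun z => (Δ (f t)) z - convect (w t) (f t) z - convect (f t) (w t) z) y := by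
      intro y
      have heq : (fun z => (Δ (f t)) z - convect (w t) (f t) z - convect (f t) (w t) z) =
          fun z => FluidPDE.timeDerivWithin (Icc 0 T) f t z + gradient (π t) z := by
        funext z; rw [hmom z]; abel
      rw [heq]
      exact (((hft.contDiff_slice ht).differentiable (by simp)).differentiableAt).add
        ((((hπ.gradient hU).contDiff_slice ht).differentiable (by simp)).differentiableAt)
    have hdiffP : ∀ y, DifferentiableAt ℝ (gradient (π t)) y := fun y =>
      (((hπ.gradient hU).contDiff_slice ht).differentiable (by simp)).differentiableAt
    have hcurl : ∀ x, curl (FluidPDE.timeDerivWithin (Icc 0 T) f t) x =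
        curl (fun y => (Δ (f t)) y - convect (w t) (f t) y - convect (f t) (w t) y) x := by
      intro x
      have heq : FluidPDE.timeDerivWithin (Icc 0 T) f t =
          fun y => ((Δ (f t)) y - convect (w t) (f t) y - convect (f t) (w t) y) - gradient (π t) y :=
        funext hmom
      rw [heq, curl_sub (hdiffA x) (hdiffP x),
        curl_gradient_eq_zero_holds (π t) ((hπ.contDiff_slice ht).of_le (by norm_cast)) x, sub_zero]
    rw [curlPairing]
    refine integral_congr_ae (Eventually.of_forall fun x => ?_)
    simp only [hWtx, hWt t ht x, hζt, hcurl x, real_inner_smul_left, real_inner_smul_right]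
    ring
  -- ### the certificate at each slice: flux ≤ 2 Λ E
  have hslice : ∀ t ∈ Icc 0 T, (∫ x, 2 * ⟪W t x, FluidPDE.timeDerivWithin (Icc 0 T) W t x⟫) ≤
      2 * Λ t * ∫ x, ‖W t x‖ ^ 2 := by
    intro t ht
    rw [hflux t ht, hEW t]
    exact hcert t ht (f t) (hf.contDiff_slice ht) (hd.hasRapidSpatialDecay_slice hf hT ht) (hsol.divFree t ht)
  -- ### Grönwall
  set E : ℝ → ℝ := fun t => ∫ x, ‖W t x‖ ^ 2 with hEdef
  have hE0 : ∀ t, 0 ≤ E t := fun t => integral_nonneg fun x => sq_nonneg _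
  have hkc : ContinuousOn (fun s => 2 * Λ s * E s + 2 * (0 : ℝ) * Real.sqrt (E s)) (Icc 0 T) :=
    ((continuousOn_const.mul hΛc).mul hEcont).add ((continuousOn_const.mul continuousOn_const).mul hEcont.sqrt)
  have hle : ∀ t ∈ Icc 0 T,
      E t ≤ E 0 + ∫ s in (0 : ℝ)..t, (2 * Λ s * E s + 2 * (0 : ℝ) * Real.sqrt (E s)) := by
    intro t ht
    rcases eq_or_lt_of_le ht.1 with h0 | h0
    · rw [← h0, intervalIntegral.integral_same, add_zero]
    have hΦii : IntervalIntegrable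
        (fun s => ∫ x, 2 * ⟪W s x, FluidPDE.timeDerivWithin (Icc 0 T) W s x⟫) volume 0 t :=
      (intervalIntegrable_iff_integrableOn_Ioo_of_le h0.le).2
        (hΦint.mono_set (Ioo_subset_Ioo le_rfl ht.2))
    have hkc' : ContinuousOn (fun s => 2 * Λ s * E s + 2 * (0 : ℝ) * Real.sqrt (E s)) (Icc 0 t) :=
      hkc.mono (Icc_subset_Icc le_rfl ht.2)
    have hmono : (∫ s in (0 : ℝ)..t, ∫ x, 2 * ⟪W s x, FluidPDE.timeDerivWithin (Icc 0 T) W s x⟫) ≤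
        ∫ s in (0 : ℝ)..t, (2 * Λ s * E s + 2 * (0 : ℝ) * Real.sqrt (E s)) :=
      intervalIntegral.integral_mono_on h0.le hΦii (hkc'.intervalIntegrable_of_Icc h0.le)
        fun s hs => by
          have h1 := hslice s ⟨hs.1, hs.2.trans ht.2⟩
          simp only [mul_zero, zero_mul, add_zero]
          exact h1
    have hb := hbal t ⟨h0, ht.2⟩
    show (∫ x, ‖W t x‖ ^ 2) ≤ (∫ x, ‖W 0 x‖ ^ 2) + _
    rw [hb]
    linarith
  have hgr := sqrt_le_mul_exp_of_le_add_intervalIntegral hEcont (fun t _ => hE0 t) hΛc continuousOn_const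
    hΛ0 (fun _ _ => le_rfl) hle
  intro t ht
  have h1 := hgr t ht
  rw [intervalIntegral.integral_zero, add_zero] at h1
  have h2 : E t ≤ (Real.sqrt (E 0) * Real.exp (∫ s in (0 : ℝ)..t, Λ s)) ^ 2 := by
    calc E t = (Real.sqrt (E t)) ^ 2 := (Real.sq_sqrt (hE0 t)).symm
      _ ≤ _ := pow_le_pow_left₀ (Real.sqrt_nonneg _) h1 2
  have h3 : (Real.sqrt (E 0) * Real.exp (∫ s in (0 : ℝ)..t, Λ s)) ^ 2 =
      Real.exp (2 * ∫ s in (0 : ℝ)..t, Λ s) * E 0 := by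
    rw [mul_pow, Real.sq_sqrt (hE0 0), ← Real.exp_nat_mul]
    push_cast
    ring
  rw [← hEW t, ← hEW 0]
  exact h2.trans (le_of_eq h3)

end Summit.NavierStokesRegularity.FluidComputer.PalasekTowerClayBridge.WeightDoor

end
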